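import Literature.Topology.FourManifolds.HCobordismLocalIsotopy
import Literature.Topology.FourManifolds.FramedTubularNbhd
import Literature.Topology.FourManifolds.InverseFunctionTheorem
import Mathlib.Analysis.Calculus.BumpFunction.FiniteDimension
import Mathlib.Analysis.Calculus.MeanValue
import Mathlib.Analysis.Normed.Module.FiniteDimension
import HarnessLib

/-!
# Globalising a local embedding: blending a germ at `0` with its linearisation (the input of
# Milnor's Theorem 5.6 from the germ of `h₀⁻¹h`)

Topic `Literature/Topology/FourManifolds` (fact seat
`provefact-Literature.Topology.FourManifolds.Cobord-8b1ec36bf6`, tenure on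
`Literature.Topology.FourManifolds.Cobordism.Milnor1965_cancellation_modelChart`).  Everything here
is **proved**; no named facts.

Milnor, *Lectures on the h-cobordism theorem* (1965), PDF p. 32, applies the local Theorem 5.6
— stated for *"an orientation-preserving imbedding of `Rⁿ` into `Rⁿ`"* — to the map `h₀⁻¹h`,
which is only defined (and a diffeomorphism onto its image) on a small neighbourhood of `p₁`
in the level `f⁻¹(b₁)`; the usual implicit step is that a germ of diffeomorphism at `0` with
`h(0) = 0` extends, after shrinking, to an embedding of all of `Rⁿ`.  This file supplies that
step in the form needed for `Literature.Topology.FourManifolds.IsMilnorLocalEmbedding` (the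
Lean hypothesis of `Literature.Topology.FourManifolds.Milnor1965_localIsotopy`): for `Φ` smooth
near `0` with `Φ(0) = 0` and invertible derivative `L = DΦ(0)`, the blend
`Ψ = L + χ_ε · (Φ - L)` with a bump function `χ_ε` (`= 1` on the `ε`-ball, `= 0` off the
`2ε`-ball) agrees with `Φ` on the `ε`-ball, with `L` off the `2ε`-ball, and for `ε` small has
`‖DΨ - L‖` uniformly small (mean value inequality and `‖Dχ_ε‖ ≤ C/ε`); hence `Ψ` is an
injective local diffeomorphism of `Rⁿ` — a smooth embedding — with `det DΨ` of constant sign,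
and when `Rⁿ = Rᵃ × Rᵇ` and the block `A` of `L` is invertible, `Ψ(u, 0) ∈ Rᵇ` only for `u = 0`.

## Contents (all proved)

* `Literature.Topology.FourManifolds.scaledBump χ ε` — the rescaled bump `x ↦ χ(ε⁻¹x)`, with
  `= 1` / `= 0` regions and the derivative bound `‖D(scaledBump χ ε)(x)‖ ≤ C/ε`;
* `Literature.Topology.FourManifolds.exists_blend_near_linear` — the blend `Ψ` and its estimates
  (general finite-dimensional `E`);
* `Literature.Topology.FourManifolds.norm_sub_le_of_norm_fderiv_sub_le`,
  `injective_of_norm_sub_le` — a map with `‖DΨ - L‖ ≤ κ`, `2κ‖L⁻¹‖ ≤ 1`, is (anti-Lipschitz)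
  injective, and so is each `DΨ(x)`;
* `Literature.Topology.FourManifolds.exists_isMilnorLocalEmbedding_extension` — on `Rᵃ × Rᵇ`:
  an `IsMilnorLocalEmbedding` agreeing with `Φ` near `0` (given `det L > 0`, `det A > 0`).

## References

* J. Milnor, *Lectures on the h-cobordism theorem*, notes by L. Siebenmann and J. Sondow,
  Princeton Mathematical Notes (1965): Thm. 5.6 and its use in the proof of Thm. 5.4,
  Assertion 6 (PDF p. 32).  Held: `lit read book:milnornd-lectures-h-cobordism-theorem`.
  [MilnorHCobordism1965]
* J. M. Lee, *Introduction to Smooth Manifolds*, 2nd ed. (2013), Thm. 4.5 (inverse function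
  theorem), Prop. 5.2. [LeeSmoothManifolds2013]
-/

open scoped Manifold ContDiff Topology NNReal
open Set Function Filter Metric

noncomputable section

namespace Literature.Topology.FourManifolds

universe u

/-- Local notation: `𝔼 n` is the model Euclidean space `EuclideanSpace ℝ (Fin n)`. -/
local notation "𝔼 " n:arg => EuclideanSpace ℝ (Fin n)

/-! ### Rescaled bump functions -/

section Bump

variable {E : Type*} [NormedAddCommGroup E] [NormedSpace ℝ E] [FiniteDimensional ℝ E]

/-- The rescaled bump function `x ↦ χ(ε⁻¹ x)`. [folklore] -/
def scaledBump (χ : ContDiffBump (0 : E)) (ε : ℝ) (x : E) : ℝ := χ (ε⁻¹ • x)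

variable (χ : ContDiffBump (0 : E)) {ε : ℝ}

/-- The rescaled bump is smooth. [folklore] -/
theorem contDiff_scaledBump (ε : ℝ) : ContDiff ℝ ∞ (scaledBump χ ε) :=
  χ.contDiff.comp (contDiff_const_smul ε⁻¹)

/-- `|χ_ε| ≤ 1`. [folklore] -/
theorem abs_scaledBump_le_one (ε : ℝ) (x : E) : |scaledBump χ ε x| ≤ 1 := by
  rw [scaledBump, abs_of_nonneg χ.nonneg]
  exact χ.le_one

/-- `χ_ε = 1` on the ball of radius `ε rIn`. [folklore] -/
theorem scaledBump_eq_one (hε : 0 < ε) {x : E} (hx : ‖x‖ ≤ ε * χ.rIn) : scaledBump χ ε x = 1 := by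
  refine χ.one_of_mem_closedBall ?_
  rw [mem_closedBall, dist_zero_right, norm_smul, norm_inv, Real.norm_eq_abs, abs_of_pos hε]
  rwa [inv_mul_le_iff₀ hε]

/-- `χ_ε = 0` off the ball of radius `ε rOut`. [folklore] -/
theorem scaledBump_eq_zero (hε : 0 < ε) {x : E} (hx : ε * χ.rOut ≤ ‖x‖) : scaledBump χ ε x = 0 := by
  refine χ.zero_of_le_dist ?_
  rw [dist_zero_right, norm_smul, norm_inv, Real.norm_eq_abs, abs_of_pos hε]
  rwa [le_inv_mul_iff₀ hε]

/-- **The derivative bound `‖Dχ_ε(x)‖ ≤ C / ε`** with `C` independent of `ε`. [folklore] -/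
theorem exists_norm_fderiv_scaledBump_le :
    ∃ C : ℝ, 0 ≤ C ∧ ∀ ε : ℝ, 0 < ε → ∀ x : E, ‖fderiv ℝ (scaledBump χ ε) x‖ ≤ C / ε := by
  obtain ⟨C, hC⟩ := ((χ.contDiff (n := 1)).continuous_fderiv one_ne_zero).bounded_above_of_compact_support
    (χ.hasCompactSupport.fderiv (𝕜 := ℝ))
  refine ⟨max C 0, le_max_right _ _, fun ε hε x => ?_⟩
  have hd : HasFDerivAt (scaledBump χ ε)
      ((fderiv ℝ χ (ε⁻¹ • x)).comp (ε⁻¹ • ContinuousLinearMap.id ℝ E)) x := by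
    have h1 : HasFDerivAt (fun y : E => ε⁻¹ • y) (ε⁻¹ • ContinuousLinearMap.id ℝ E) x :=
      (hasFDerivAt_id x).const_smul ε⁻¹
    exact ((χ.contDiff (n := 1)).differentiable one_ne_zero _).hasFDerivAt.comp x h1
  rw [hd.fderiv]
  calc ‖(fderiv ℝ (⇑χ) (ε⁻¹ • x)).comp (ε⁻¹ • ContinuousLinearMap.id ℝ E)‖
      ≤ ‖fderiv ℝ (⇑χ) (ε⁻¹ • x)‖ * ‖ε⁻¹ • ContinuousLinearMap.id ℝ E‖ :=
        ContinuousLinearMap.opNorm_comp_le _ _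
    _ ≤ max C 0 * ε⁻¹ := by
        refine mul_le_mul ((hC _).trans (le_max_left _ _)) ?_ (norm_nonneg _) (le_max_right _ _)
        rw [norm_smul, norm_inv, Real.norm_eq_abs, abs_of_pos hε]
        exact mul_le_of_le_one_right (inv_nonneg.2 hε.le) ContinuousLinearMap.norm_id_le
    _ = max C 0 / ε := by rw [div_eq_mul_inv]

end Bump

/-! ### The blend with the linearisation -/

section Blend

variable {E : Type*} [NormedAddCommGroup E] [NormedSpace ℝ E] [FiniteDimensional ℝ E]

/-- **Blending a germ with its linearisation.**  Let `Φ : E → E` be smooth on an open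
neighbourhood `U` of `0` with `Φ(0) = 0` and derivative `L` at `0`.  For every `κ > 0` and
`r > 0` there are `ε > 0` with `2ε < r`, `B̄(0, 2ε) ⊆ U`, and a smooth `Ψ : E → E` with
`Ψ = Φ` on `B̄(0, ε)`, `Ψ = L` off `B(0, 2ε)`, `Ψ(0) = 0`, `DΨ(0) = L`, `‖DΨ(x) - L‖ ≤ κ`
and `‖Ψ(x) - Lx‖ ≤ κ‖x‖` for all `x`. [folklore] -/
theorem exists_blend_near_linear {Φ : E → E} {U : Set E} (hU : IsOpen U) (h0U : (0 : E) ∈ U)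
    (hΦ : ContDiffOn ℝ ∞ Φ U) (h0 : Φ 0 = 0) (L : E →L[ℝ] E) (hL : HasFDerivAt Φ L 0)
    {κ : ℝ} (hκ : 0 < κ) {r : ℝ} (hr : 0 < r) :
    ∃ ε : ℝ, 0 < ε ∧ 2 * ε < r ∧ closedBall (0 : E) (2 * ε) ⊆ U ∧
      ∃ Ψ : E → E, ContDiff ℝ ∞ Ψ ∧ (∀ x, ‖x‖ ≤ ε → Ψ x = Φ x) ∧
        (∀ x, 2 * ε ≤ ‖x‖ → Ψ x = L x) ∧ Ψ 0 = 0 ∧ fderiv ℝ Ψ 0 = L ∧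
        (∀ x, ‖fderiv ℝ Ψ x - L‖ ≤ κ) ∧ (∀ x, ‖Ψ x - L x‖ ≤ κ * ‖x‖) := by
  -- a bump `χ` with `rIn = 1`, `rOut = 2`, and the derivative bound of its rescalings
  let χ : ContDiffBump (0 : E) := ⟨1, 2, one_pos, one_lt_two⟩
  obtain ⟨C, hC0, hC⟩ := exists_norm_fderiv_scaledBump_le χ
  -- the remainder `R = Φ - L`: smooth on `U`, `R 0 = 0`, `DR(0) = 0`
  set R : E → E := fun x => Φ x - L x with hR
  have hRU : ContDiffOn ℝ ∞ R U := hΦ.sub L.contDiff.contDiffOn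
  have hR0 : R 0 = 0 := by simp [hR, h0]
  have hRd0 : HasFDerivAt R (0 : E →L[ℝ] E) 0 := by
    have : HasFDerivAt (fun x => Φ x - L x) (L - L) 0 := hL.sub L.hasFDerivAt
    simpa using this
  have hRat : ∀ x ∈ U, ContDiffAt ℝ ∞ R x := fun x hx => hRU.contDiffAt (hU.mem_nhds hx)
  -- continuity of `DR` at `0`: a radius `δ` with `B(0, δ) ⊆ U` and `‖DR‖ ≤ κ'` there
  set κ' : ℝ := κ / (1 + 2 * C) with hκ'
  have hκ'pos : 0 < κ' := div_pos hκ (by linarith)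
  have hκ'κ : κ' ≤ κ := div_le_self hκ.le (by linarith)
  have hcont : ContinuousAt (fderiv ℝ R) 0 :=
    ((hRat 0 h0U).fderiv_right (m := 0) (by simp)).continuousAt
  obtain ⟨δ, hδ, hδU, hδR⟩ : ∃ δ > 0, ball (0 : E) δ ⊆ U ∧
      ∀ y ∈ ball (0 : E) δ, ‖fderiv ℝ R y‖ ≤ κ' := by
    obtain ⟨δ₁, hδ₁, h₁⟩ := Metric.isOpen_iff.1 hU 0 h0U
    have hlt : ‖fderiv ℝ R 0‖ < κ' := by rw [hRd0.fderiv, norm_zero]; exact hκ'pos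
    have hev : ∀ᶠ y in 𝓝 (0 : E), ‖fderiv ℝ R y‖ < κ' := hcont.norm.eventually (gt_mem_nhds hlt)
    obtain ⟨δ₂, hδ₂, h₂⟩ := Metric.eventually_nhds_iff.1 hev
    refine ⟨min δ₁ δ₂, lt_min hδ₁ hδ₂, fun y hy => h₁ (ball_subset_ball (min_le_left _ _) hy),
      fun y hy => (h₂ ?_).le⟩
    exact lt_of_lt_of_le (mem_ball.1 hy) (min_le_right _ _)
  -- differentiability and the mean value bound `‖R y‖ ≤ κ' ‖y‖` on `B(0, δ)`
  have hRdiff : ∀ y ∈ ball (0 : E) δ, DifferentiableAt ℝ R y :=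
    fun y hy => (hRat y (hδU hy)).differentiableAt (by simp)
  have hRle : ∀ y ∈ ball (0 : E) δ, ‖R y‖ ≤ κ' * ‖y‖ := by
    intro y hy
    have := (convex_ball (0 : E) δ).norm_image_sub_le_of_norm_fderiv_le hRdiff hδR
      (mem_ball_self hδ) hy
    simpa [hR0] using this
  -- the radius `ε`
  set ε : ℝ := min (δ / 4) (r / 4) with hε
  have hεpos : 0 < ε := lt_min (by linarith) (by linarith)
  have hεδ : 2 * ε < δ := by
    have := min_le_left (δ / 4) (r / 4)
    linarith
  have hεr : 2 * ε < r := by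
    have := min_le_right (δ / 4) (r / 4)
    linarith
  have hballU : closedBall (0 : E) (2 * ε) ⊆ U := fun x hx =>
    hδU (mem_ball.2 (lt_of_le_of_lt (mem_closedBall.1 hx) hεδ))
  -- the blend
  set Ψ : E → E := fun x => L x + scaledBump χ ε x • R x with hΨ
  have hχ1 : ∀ x : E, ‖x‖ ≤ ε → scaledBump χ ε x = 1 := fun x hx =>
    scaledBump_eq_one χ hεpos (by rw [show χ.rIn = 1 from rfl, mul_one]; exact hx)
  have hχ0 : ∀ x : E, 2 * ε ≤ ‖x‖ → scaledBump χ ε x = 0 := fun x hx =>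
    scaledBump_eq_zero χ hεpos (by rw [show χ.rOut = 2 from rfl]; linarith)
  have hΨΦ : ∀ x, ‖x‖ ≤ ε → Ψ x = Φ x := fun x hx => by
    simp only [hΨ, hχ1 x hx, one_smul, hR]
    abel
  have hΨL : ∀ x, 2 * ε ≤ ‖x‖ → Ψ x = L x := fun x hx => by
    simp only [hΨ, hχ0 x hx, zero_smul, add_zero]
  have hΨ0 : Ψ 0 = 0 := by
    simp only [hΨ, map_zero, hR0, smul_zero, add_zero]
  -- derivative formula on `B(0, δ)`
  have hΨd : ∀ y ∈ ball (0 : E) δ, HasFDerivAt Ψ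
      (L + (scaledBump χ ε y • fderiv ℝ R y + (fderiv ℝ (scaledBump χ ε) y).smulRight (R y))) y := by
    intro y hy
    have hχd : HasFDerivAt (scaledBump χ ε) (fderiv ℝ (scaledBump χ ε) y) y :=
      ((contDiff_scaledBump χ ε).differentiable (by simp) y).hasFDerivAt
    exact L.hasFDerivAt.add (hχd.smul (hRdiff y hy).hasFDerivAt)
  -- `Ψ = L` near every point with `2ε < ‖y‖`
  have hΨLev : ∀ y : E, 2 * ε < ‖y‖ → Ψ =ᶠ[𝓝 y] fun x => L x := by
    intro y hy
    have : ∀ᶠ x in 𝓝 y, 2 * ε < ‖x‖ := continuous_norm.continuousAt.eventually (lt_mem_nhds hy)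
    exact this.mono fun x hx => hΨL x hx.le
  -- smoothness
  have hΨs : ContDiff ℝ ∞ Ψ := by
    rw [contDiff_iff_contDiffAt]
    intro y
    by_cases hy : y ∈ U
    · exact L.contDiff.contDiffAt.add ((contDiff_scaledBump χ ε).contDiffAt.smul (hRat y hy))
    · have hy2 : 2 * ε < ‖y‖ := by
        by_contra h
        push Not at h
        exact hy (hballU (mem_closedBall.2 (by rwa [dist_zero_right])))
      exact L.contDiff.contDiffAt.congr_of_eventuallyEq (hΨLev y hy2)
  -- `DΨ(0) = L`
  have hΨd0 : fderiv ℝ Ψ 0 = L := by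
    rw [(hΨd 0 (mem_ball_self hδ)).fderiv, hRd0.fderiv, hR0, smul_zero, zero_add]
    ext w
    simp
  -- the derivative bound
  have hDb : ∀ y, ‖fderiv ℝ Ψ y - L‖ ≤ κ := by
    intro y
    by_cases hy : ‖y‖ ≤ 2 * ε
    · have hyδ : y ∈ ball (0 : E) δ := mem_ball.2 (by rw [dist_zero_right]; linarith)
      rw [(hΨd y hyδ).fderiv, add_sub_cancel_left]
      have h1 : ‖scaledBump χ ε y • fderiv ℝ R y‖ ≤ κ' := by
        rw [norm_smul, Real.norm_eq_abs]
        calc |scaledBump χ ε y| * ‖fderiv ℝ R y‖ ≤ 1 * κ' :=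
              mul_le_mul (abs_scaledBump_le_one χ ε y) (hδR y hyδ) (norm_nonneg _) zero_le_one
          _ = κ' := one_mul _
      have h2 : ‖(fderiv ℝ (scaledBump χ ε) y).smulRight (R y)‖ ≤ C / ε * (κ' * (2 * ε)) := by
        rw [ContinuousLinearMap.norm_smulRight_apply]
        refine mul_le_mul (hC ε hεpos y) ((hRle y hyδ).trans ?_) (norm_nonneg _)
          (div_nonneg hC0 hεpos.le)
        exact mul_le_mul_of_nonneg_left hy hκ'pos.le
      calc ‖scaledBump χ ε y • fderiv ℝ R y + (fderiv ℝ (scaledBump χ ε) y).smulRight (R y)‖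
          ≤ ‖scaledBump χ ε y • fderiv ℝ R y‖ + ‖(fderiv ℝ (scaledBump χ ε) y).smulRight (R y)‖ :=
            norm_add_le _ _
        _ ≤ κ' + C / ε * (κ' * (2 * ε)) := add_le_add h1 h2
        _ = κ := by
            rw [hκ']
            field_simp
    · push Not at hy
      rw [(hΨLev y hy).fderiv_eq, L.fderiv, sub_self, norm_zero]
      exact hκ.le
  -- the value bound
  have hΨb : ∀ x, ‖Ψ x - L x‖ ≤ κ * ‖x‖ := by
    intro x
    by_cases hx : ‖x‖ < 2 * ε
    · have hxδ : x ∈ ball (0 : E) δ := mem_ball.2 (by rw [dist_zero_right]; linarith)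
      have : Ψ x - L x = scaledBump χ ε x • R x := by
        simp only [hΨ]
        abel
      rw [this, norm_smul, Real.norm_eq_abs]
      calc |scaledBump χ ε x| * ‖R x‖ ≤ 1 * (κ' * ‖x‖) :=
            mul_le_mul (abs_scaledBump_le_one χ ε x) (hRle x hxδ) (norm_nonneg _) zero_le_one
        _ ≤ κ * ‖x‖ := by rw [one_mul]; exact mul_le_mul_of_nonneg_right hκ'κ (norm_nonneg _)
    · push Not at hx
      rw [hΨL x hx, sub_self, norm_zero]
      positivity
  exact ⟨ε, hεpos, hεr, hballU, Ψ, hΨs, hΨΦ, hΨL, hΨ0, hΨd0, hDb, hΨb⟩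

/-! ### Injectivity from a uniformly close derivative -/

omit [FiniteDimensional ℝ E] in
/-- **A linear map `D` with `‖D - L‖ ≤ κ`, `2κ‖L⁻¹‖ ≤ 1`, is bounded below:**
`‖w‖ ≤ 2‖L⁻¹‖ ‖Dw‖`. [folklore] -/
theorem norm_le_of_norm_sub_le (D : E →L[ℝ] E) (L : E ≃L[ℝ] E) {κ : ℝ}
    (hD : ‖D - (L : E →L[ℝ] E)‖ ≤ κ) (hκ : 2 * κ * ‖(L.symm : E →L[ℝ] E)‖ ≤ 1) (w : E) :
    ‖w‖ ≤ 2 * ‖(L.symm : E →L[ℝ] E)‖ * ‖D w‖ := by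
  set M : ℝ := ‖(L.symm : E →L[ℝ] E)‖ with hM
  have hM0 : 0 ≤ M := norm_nonneg _
  have h1 : ‖w‖ ≤ M * ‖L w‖ := by
    calc ‖w‖ = ‖(L.symm : E →L[ℝ] E) (L w)‖ := by simp
      _ ≤ M * ‖L w‖ := (L.symm : E →L[ℝ] E).le_opNorm _
  have h2 : ‖(L : E →L[ℝ] E) w‖ ≤ ‖D w‖ + κ * ‖w‖ := by
    have heq : (L : E →L[ℝ] E) w = D w - (D - (L : E →L[ℝ] E)) w := by simp
    rw [heq]
    calc ‖D w - (D - (L : E →L[ℝ] E)) w‖ ≤ ‖D w‖ + ‖(D - (L : E →L[ℝ] E)) w‖ := norm_sub_le _ _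
      _ ≤ ‖D w‖ + κ * ‖w‖ := by
          gcongr
          exact ((D - (L : E →L[ℝ] E)).le_opNorm w).trans (mul_le_mul_of_nonneg_right hD (norm_nonneg _))
  have h2' : ‖L w‖ ≤ ‖D w‖ + κ * ‖w‖ := h2
  have h3 : M * ‖L w‖ ≤ M * (‖D w‖ + κ * ‖w‖) := mul_le_mul_of_nonneg_left h2' hM0
  have h4 : M * κ * ‖w‖ ≤ ‖w‖ / 2 := by
    have := mul_le_mul_of_nonneg_right hκ (norm_nonneg w)
    nlinarith [norm_nonneg w]
  nlinarith [h1, h3, h4, norm_nonneg (D w)]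

omit [FiniteDimensional ℝ E] in
/-- **A map `Ψ` with `‖DΨ - L‖ ≤ κ` everywhere, `2κ‖L⁻¹‖ ≤ 1`, is anti-Lipschitz:**
`‖x - y‖ ≤ 2‖L⁻¹‖ ‖Ψ x - Ψ y‖` (mean value inequality for `Ψ - L`). [folklore] -/
theorem norm_sub_le_of_norm_fderiv_sub_le {Ψ : E → E} (hΨ : Differentiable ℝ Ψ) (L : E ≃L[ℝ] E)
    {κ : ℝ} (hD : ∀ x, ‖fderiv ℝ Ψ x - (L : E →L[ℝ] E)‖ ≤ κ)
    (hκ : 2 * κ * ‖(L.symm : E →L[ℝ] E)‖ ≤ 1) (x y : E) :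
    ‖x - y‖ ≤ 2 * ‖(L.symm : E →L[ℝ] E)‖ * ‖Ψ x - Ψ y‖ := by
  set M : ℝ := ‖(L.symm : E →L[ℝ] E)‖ with hM
  have hM0 : 0 ≤ M := norm_nonneg _
  -- `g = Ψ - L` is `κ`-Lipschitz
  set g : E → E := fun z => Ψ z - (L : E →L[ℝ] E) z with hg
  have hgd : ∀ z ∈ (univ : Set E), DifferentiableAt ℝ g z :=
    fun z _ => (hΨ z).sub (L : E →L[ℝ] E).differentiableAt
  have hgb : ∀ z ∈ (univ : Set E), ‖fderiv ℝ g z‖ ≤ κ := by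
    intro z _
    have : fderiv ℝ g z = fderiv ℝ Ψ z - (L : E →L[ℝ] E) := by
      rw [hg, fderiv_fun_sub (hΨ z) (L : E →L[ℝ] E).differentiableAt, ContinuousLinearMap.fderiv]
    rw [this]
    exact hD z
  have hglip : ‖g x - g y‖ ≤ κ * ‖x - y‖ :=
    convex_univ.norm_image_sub_le_of_norm_fderiv_le hgd hgb (mem_univ y) (mem_univ x)
  -- combine with `‖w‖ ≤ M ‖L w‖`
  have h1 : ‖x - y‖ ≤ M * ‖L (x - y)‖ := by
    calc ‖x - y‖ = ‖(L.symm : E →L[ℝ] E) (L (x - y))‖ := by simp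
      _ ≤ M * ‖L (x - y)‖ := (L.symm : E →L[ℝ] E).le_opNorm _
  have h2 : ‖L (x - y)‖ ≤ ‖Ψ x - Ψ y‖ + κ * ‖x - y‖ := by
    have heq : L (x - y) = (Ψ x - Ψ y) - (g x - g y) := by
      simp only [hg, map_sub, ContinuousLinearEquiv.coe_coe]
      abel
    rw [heq]
    exact (norm_sub_le _ _).trans (by linarith)
  have h3 : M * ‖L (x - y)‖ ≤ M * (‖Ψ x - Ψ y‖ + κ * ‖x - y‖) := mul_le_mul_of_nonneg_left h2 hM0
  have h4 : M * κ * ‖x - y‖ ≤ ‖x - y‖ / 2 := by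
    have := mul_le_mul_of_nonneg_right hκ (norm_nonneg (x - y))
    nlinarith [norm_nonneg (x - y)]
  nlinarith [h1, h3, h4, norm_nonneg (Ψ x - Ψ y)]

/-- An endomorphism of a finite-dimensional space with non-zero determinant is injective. [folklore] -/
theorem ker_eq_bot_of_det_ne_zero (L : E →L[ℝ] E) (h : LinearMap.det (L : E →ₗ[ℝ] E) ≠ 0) :
    LinearMap.ker (L : E →ₗ[ℝ] E) = ⊥ :=
  (LinearMap.isUnit_iff_ker_eq_bot _).1 ((LinearMap.isUnit_iff_isUnit_det _).2 (isUnit_iff_ne_zero.2 h))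

/-- An endomorphism of a finite-dimensional space with non-zero determinant is surjective. [folklore] -/
theorem range_eq_top_of_det_ne_zero (L : E →L[ℝ] E) (h : LinearMap.det (L : E →ₗ[ℝ] E) ≠ 0) :
    LinearMap.range (L : E →ₗ[ℝ] E) = ⊤ :=
  LinearMap.range_eq_top.2 (LinearMap.injective_iff_surjective.1
    (LinearMap.ker_eq_bot.1 (ker_eq_bot_of_det_ne_zero L h)))

/-- An endomorphism of a finite-dimensional space with non-zero determinant, as a continuous
linear equivalence. [folklore] -/
def equivOfDetNeZero (L : E →L[ℝ] E) (h : LinearMap.det (L : E →ₗ[ℝ] E) ≠ 0) : E ≃L[ℝ] E :=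
  ContinuousLinearEquiv.ofBijective L (ker_eq_bot_of_det_ne_zero L h) (range_eq_top_of_det_ne_zero L h)

/-- `equivOfDetNeZero L h` is `L`. [folklore] -/
@[simp]
theorem coe_equivOfDetNeZero (L : E →L[ℝ] E) (h : LinearMap.det (L : E →ₗ[ℝ] E) ≠ 0) :
    (equivOfDetNeZero L h : E →L[ℝ] E) = L :=
  ContinuousLinearEquiv.coe_ofBijective L (ker_eq_bot_of_det_ne_zero L h) (range_eq_top_of_det_ne_zero L h)

/-- **An injective smooth map of `E` with everywhere injective derivative is a smooth embedding**
(injective local diffeomorphism, inverse function theorem). [cite: LeeSmoothManifolds2013, Thm. 4.5, Prop. 5.2] -/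
theorem isSmoothEmbedding_of_injective_fderiv {Ψ : E → E} (hΨ : ContDiff ℝ ∞ Ψ) (hinj : Injective Ψ)
    (hD : ∀ x, Injective (fderiv ℝ Ψ x)) :
    Manifold.IsSmoothEmbedding 𝓘(ℝ, E) 𝓘(ℝ, E) ∞ Ψ := by
  have hloc : IsLocalDiffeomorph 𝓘(ℝ, E) 𝓘(ℝ, E) ∞ Ψ := by
    intro x
    have hsurj : Surjective (fderiv ℝ Ψ x) :=
      (LinearMap.injective_iff_surjective (f := (fderiv ℝ Ψ x : E →ₗ[ℝ] E))).1 (hD x)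
    let Lx : E ≃L[ℝ] E := ContinuousLinearEquiv.ofBijective (fderiv ℝ Ψ x)
      (LinearMap.ker_eq_bot.2 (hD x)) (LinearMap.range_eq_top.2 hsurj)
    refine isLocalDiffeomorphAt_of_mfderiv isOpen_univ (mem_univ x) hΨ.contMDiff.contMDiffOn
      (by simp) Lx ?_
    rw [mfderiv_eq_fderiv, ContinuousLinearEquiv.coe_ofBijective]
  exact isSmoothEmbedding_of_isLocalDiffeomorph hloc hinj (ContinuousLinearEquiv.refl ℝ E)

/-- **Constant sign of `det DΨ`**: if every `DΨ(x)` is injective (so `det ≠ 0`), `Ψ` is `C¹`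
and `det DΨ(0) > 0`, then `det DΨ(x) > 0` for all `x` (intermediate value theorem on the
connected space `E`). [folklore] -/
theorem det_fderiv_pos_of_injective {Ψ : E → E} (hΨ : ContDiff ℝ ∞ Ψ)
    (hD : ∀ x, Injective (fderiv ℝ Ψ x))
    (h0 : 0 < LinearMap.det (fderiv ℝ Ψ 0 : E →ₗ[ℝ] E)) (x : E) :
    0 < LinearMap.det (fderiv ℝ Ψ x : E →ₗ[ℝ] E) := by
  have hne : ∀ y, LinearMap.det (fderiv ℝ Ψ y : E →ₗ[ℝ] E) ≠ 0 := fun y => by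
    have hunit : IsUnit (fderiv ℝ Ψ y : E →ₗ[ℝ] E) :=
      (LinearMap.isUnit_iff_ker_eq_bot _).2 (LinearMap.ker_eq_bot.2 (hD y))
    exact ((LinearMap.isUnit_iff_isUnit_det _).1 hunit).ne_zero
  have hcont : Continuous fun y => LinearMap.det (fderiv ℝ Ψ y : E →ₗ[ℝ] E) :=
    ContinuousLinearMap.continuous_det.comp (hΨ.continuous_fderiv (by simp))
  by_contra hx
  push Not at hx
  obtain ⟨z, hz⟩ := intermediate_value_univ x 0 hcont ⟨hx, h0.le⟩
  exact hne z hz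

end Blend

/-! ### The input of Theorem 5.6 from a germ on `Rᵃ × Rᵇ` -/

section Milnor

variable {a b : ℕ}

/-- The norm of `(u, 0) ∈ Rᵃ × Rᵇ` is `‖u‖`. [folklore] -/
theorem norm_prodMk_zero (u : 𝔼 a) : ‖((u, (0 : 𝔼 b)) : 𝔼 a × 𝔼 b)‖ = ‖u‖ := by
  simp [Prod.norm_def]

/-- **Globalising the germ of `h₀⁻¹h` to an `IsMilnorLocalEmbedding`.**  Let `Φ` be smooth on an
open neighbourhood `U` of `0` in `Rᵃ × Rᵇ` with `Φ(0) = 0`, derivative `L` at `0` with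
`det L > 0` and `det A > 0` for the block `A = fstBlock L`.  Then for every `r > 0` there are
`ε > 0` (`2ε < r`, `B̄(0, 2ε) ⊆ U`) and `Ψ : Rᵃ × Rᵇ → Rᵃ × Rᵇ` satisfying the hypothesis
`Literature.Topology.FourManifolds.IsMilnorLocalEmbedding` of Thm. 5.6, agreeing with `Φ` on
`B̄(0, ε)` and with `L` off `B(0, 2ε)`, injective, with `DΨ(0) = L`.
[cite: MilnorHCobordism1965, Thm. 5.6 and proof of Thm. 5.4, Assertion 6 (PDF p. 32)] -/
theorem exists_isMilnorLocalEmbedding_extension {Φ : 𝔼 a × 𝔼 b → 𝔼 a × 𝔼 b}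
    {U : Set (𝔼 a × 𝔼 b)} (hU : IsOpen U) (h0U : (0 : 𝔼 a × 𝔼 b) ∈ U)
    (hΦ : ContDiffOn ℝ ∞ Φ U) (h0 : Φ 0 = 0) {L : (𝔼 a × 𝔼 b) →L[ℝ] (𝔼 a × 𝔼 b)}
    (hL : HasFDerivAt Φ L 0)
    (hdetL : 0 < LinearMap.det (L : (𝔼 a × 𝔼 b) →ₗ[ℝ] (𝔼 a × 𝔼 b)))
    (hdetA : 0 < LinearMap.det (fstBlock L : 𝔼 a →ₗ[ℝ] 𝔼 a)) {r : ℝ} (hr : 0 < r) :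
    ∃ ε : ℝ, 0 < ε ∧ 2 * ε < r ∧ closedBall (0 : 𝔼 a × 𝔼 b) (2 * ε) ⊆ U ∧
      ∃ Ψ : 𝔼 a × 𝔼 b → 𝔼 a × 𝔼 b, IsMilnorLocalEmbedding Ψ ∧ ContDiff ℝ ∞ Ψ ∧
        (∀ x, ‖x‖ ≤ ε → Ψ x = Φ x) ∧ (∀ x, 2 * ε ≤ ‖x‖ → Ψ x = L x) ∧
        fderiv ℝ Ψ 0 = L ∧ Injective Ψ := by
  -- the two equivalences and the smallness constant
  set Le : (𝔼 a × 𝔼 b) ≃L[ℝ] (𝔼 a × 𝔼 b) := equivOfDetNeZero L hdetL.ne' with hLe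
  set A : 𝔼 a ≃L[ℝ] 𝔼 a := equivOfDetNeZero (fstBlock L) hdetA.ne' with hA
  have hLe' : (Le : (𝔼 a × 𝔼 b) →L[ℝ] (𝔼 a × 𝔼 b)) = L := coe_equivOfDetNeZero _ _
  have hA' : (A : 𝔼 a →L[ℝ] 𝔼 a) = fstBlock L := coe_equivOfDetNeZero _ _
  set ML : ℝ := ‖(Le.symm : (𝔼 a × 𝔼 b) →L[ℝ] (𝔼 a × 𝔼 b))‖ with hML
  set MA : ℝ := ‖(A.symm : 𝔼 a →L[ℝ] 𝔼 a)‖ with hMA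
  have hML0 : 0 ≤ ML := norm_nonneg _
  have hMA0 : 0 ≤ MA := norm_nonneg _
  have hS : 0 < ML + MA + 1 := by positivity
  set κ : ℝ := 1 / (2 * (ML + MA + 1)) with hκ
  have hκpos : 0 < κ := by rw [hκ]; positivity
  have hκL : 2 * κ * ML ≤ 1 := by
    have : 2 * κ * ML = ML / (ML + MA + 1) := by rw [hκ]; field_simp
    rw [this, div_le_one hS]
    linarith
  have hκA : 2 * κ * MA ≤ 1 := by
    have : 2 * κ * MA = MA / (ML + MA + 1) := by rw [hκ]; field_simp
    rw [this, div_le_one hS]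
    linarith
  -- the blend
  obtain ⟨ε, hε, hεr, hballU, Ψ, hΨs, hΨΦ, hΨL, hΨ0, hΨd0, hDb, hΨb⟩ :=
    exists_blend_near_linear hU h0U hΦ h0 L hL hκpos hr
  have hDb' : ∀ x, ‖fderiv ℝ Ψ x - (Le : (𝔼 a × 𝔼 b) →L[ℝ] (𝔼 a × 𝔼 b))‖ ≤ κ := by
    rw [hLe']; exact hDb
  -- injectivity of `Ψ` and of its derivatives
  have hinj : Injective Ψ := by
    intro x y hxy
    have h := norm_sub_le_of_norm_fderiv_sub_le (hΨs.differentiable (by simp)) Le hDb' hκL x y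
    rw [hxy, sub_self, norm_zero, mul_zero] at h
    exact sub_eq_zero.1 (norm_le_zero_iff.1 h)
  have hDinj : ∀ x, Injective (fderiv ℝ Ψ x) := by
    intro x w₁ w₂ hw
    have h := norm_le_of_norm_sub_le (fderiv ℝ Ψ x) Le (hDb' x) hκL (w₁ - w₂)
    rw [map_sub, hw, sub_self, norm_zero, mul_zero] at h
    exact sub_eq_zero.1 (norm_le_zero_iff.1 h)
  refine ⟨ε, hε, hεr, hballU, Ψ, ⟨isSmoothEmbedding_of_injective_fderiv hΨs hinj hDinj, ?_, hΨ0, ?_, ?_⟩,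
    hΨs, hΨΦ, hΨL, hΨd0, hinj⟩
  · -- `det DΨ > 0`
    refine det_fderiv_pos_of_injective hΨs hDinj ?_
    rw [hΨd0]
    exact hdetL
  · -- `Ψ(u, 0) ∈ Rᵇ` only for `u = 0`
    intro u hu
    have hb := hΨb (u, 0)
    rw [norm_prodMk_zero] at hb
    have hAu : A u = (L (u, 0)).1 := by
      rw [show A u = (A : 𝔼 a →L[ℝ] 𝔼 a) u from rfl, hA', fstBlock_apply]
    have h1 : ‖A u‖ ≤ κ * ‖u‖ := by
      rw [hAu]
      have : (L (u, 0)).1 = -((Ψ (u, 0) - L (u, 0)).1) := by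
        rw [Prod.fst_sub, hu, zero_sub, neg_neg]
      rw [this, norm_neg]
      exact (norm_fst_le _).trans hb
    have h2 : ‖u‖ ≤ MA * ‖A u‖ := by
      calc ‖u‖ = ‖(A.symm : 𝔼 a →L[ℝ] 𝔼 a) (A u)‖ := by simp
        _ ≤ MA * ‖A u‖ := (A.symm : 𝔼 a →L[ℝ] 𝔼 a).le_opNorm _
    have h3 : ‖A u‖ ≤ 0 := by
      have h4 : κ * MA * ‖A u‖ ≤ ‖A u‖ / 2 := by
        have := mul_le_mul_of_nonneg_right hκA (norm_nonneg (A u))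
        nlinarith [norm_nonneg (A u)]
      nlinarith [h1, mul_le_mul_of_nonneg_left h2 hκpos.le, norm_nonneg u, norm_nonneg (A u)]
    have hAu0 : A u = 0 := norm_le_zero_iff.1 h3
    simpa using congrArg A.symm hAu0
  · -- `det A > 0` for the block of `DΨ(0) = L`
    rw [hΨd0]
    exact hdetA

end Milnor

end Literature.Topology.FourManifolds
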